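import Literature.NumberTheory.EllipticCurves.NewformPeterssonSizeSymmSquareProofs
import Literature.NumberTheory.EllipticCurves.CuspFormSymmSquareLSeries
import HarnessLib

/-!
# `murty_petersson_newform_lower_bound` is EQUIVALENT to Hoffstein–Lockhart's bound — the
# converse of the symmetric-square reduction, positivity at the edge, and the naive value

Topic `Literature/NumberTheory/EllipticCurves`; theorems only (no definition, no named fact).
Complement to `NewformPeterssonSizeSymmSquareProofs` (the Euler-product step of Murty 1999, §2:
for a newform `f ∈ S₂(Γ₀(N))` the good-prime symmetric-square Euler product tends, as `w → 2⁺`,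
to `(8π³/N) ∏_{p ∥ N}(1 − p^{-2}) Re(f, f)`, `IsNewform0.tendsto_tprod_symmSq`, whence the named
fact `murty_petersson_newform_lower_bound` (`NewformPeterssonSize.lean`) FOLLOWS from the printed
Hoffstein–Lockhart input `lim ≥ c(ε) N^{-ε}`, `murty_petersson_newform_lower_bound_of_symmSq_lower_bound`)
and to `CuspFormSymmSquareLSeries` (the naive symmetric-square value
`symmSqLOne f = lim_{w→2⁺} Re L^{naive}(Sym² f, w) = 8π³ Re(f,f)/N`, `symmSqLOne_eq`). It records:

* `symmSq_lower_bound_of_murty_petersson_newform_lower_bound`,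
  `murty_petersson_newform_lower_bound_iff_symmSq_lower_bound` (and the `…_lFunction` forms in the
  integers `a_p(W)`): the CONVERSE reduction, so that the named fact is *equivalent* to
  Hoffstein–Lockhart's lower bound for the newforms of elliptic curves over `ℚ` — the residual
  content of the fact, given the tree, is exactly Hoffstein–Lockhart 1994, Thm. 0.1 (with the
  Goldfeld–Hoffstein–Lieman appendix), as quoted by Murty 1999, §2. The converse uses
  `∏_{p ∥ N}(1 − p^{-2}) ≥ ∏_{n=2}^{N}(1 − n^{-2}) = (N+1)/(2N) ≥ 1/2` (`prod_Icc_one_sub_inv_sq`).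
* `murty_petersson_newform_lower_bound_iff_symmSqLOne_lower_bound`: the same equivalence with the
  naive value, `Re(f,f) ≥ c N^{1-ε} ⟺ symmSqLOne f ≥ c' N^{-ε}` — the fact is literally
  "`L^{naive}(Sym² f_E, 1) ≫_ε N^{-ε}`" in Watkins' normalisation (Watkins 2004, Lemma 3.4 is the
  explicit `≥ 0.033/log N⁽²⁾` for the complete `L`-function).
* `IsNewform0.symmSq_limit_pos`, `IsNewform0.exists_pos_tendsto_tprod_symmSq`: the edge limit of
  the good-prime symmetric-square Euler product of ANY newform in `S₂(Γ₀(N))` exists and is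
  POSITIVE (`Re(f,f) > 0` by Pasten's trivial bound `peterssonProduct_re_ge_of_isNormalized`) —
  the non-vanishing of the symmetric square at the edge of absolute convergence (Rankin 1939;
  Ogg 1969), in the tree's real-variable form.
* `IsNewform0.tendsto_tprod_symmSq_symmSqLOne`: the bridge between the two objects,
  `lim_{w→2⁺} ∏_{p∤N}(…)⁻¹ = symmSqLOne f · ∏_{p ∥ N}(1 − p^{-2})`.

## References

* [Murty1999CongruencePrimes] M. R. Murty, *Bounds for congruence primes* (1999), §2 p. 7.
* [HoffsteinLockhart1994] J. Hoffstein, P. Lockhart, Ann. of Math. 140 (1994), Thm. 0.1, with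
  the appendix by D. Goldfeld, J. Hoffstein, D. Lieman.
* [Watkins2004] M. Watkins, arXiv:math/0408126, §1 and Lemma 3.4 (read).
* [Rankin1939] R. A. Rankin, Proc. Cambridge Philos. Soc. 35 (1939).
-/

noncomputable section

open scoped MatrixGroups Real Topology
open Filter CongruenceSubgroup

namespace Literature.NumberTheory.EllipticCurves.ModularForms

/-! ### An elementary lower bound for `∏_{p ∥ N} (1 − p^{-2})` -/

section Elementary

/-- Telescoping: `∏_{n=2}^{M} (1 − 1/n²) = (M + 1)/(2M)` for `M ≥ 1`. [folklore] -/
theorem prod_Icc_one_sub_inv_sq (M : ℕ) (hM : 1 ≤ M) :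
    ∏ n ∈ Finset.Icc 2 M, (1 - ((n : ℝ) ^ 2)⁻¹) = ((M : ℝ) + 1) / (2 * (M : ℝ)) := by
  induction M with
  | zero => omega
  | succ m ih =>
    rcases Nat.eq_zero_or_pos m with rfl | hm
    · norm_num
    · rw [Finset.prod_Icc_succ_top (by omega), ih hm]
      have hm0 : (m : ℝ) ≠ 0 := by exact_mod_cast hm.ne'
      have hm1 : (m : ℝ) + 1 ≠ 0 := by positivity
      push_cast
      field_simp
      ring

/-- `1/2 ≤ ∏_{p ∥ N} (1 − p^{-2})` (the bad-prime factor of `IsNewform0.tendsto_tprod_symmSq`):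
the primes `p ∥ N` lie in `[2, N]`, all factors are in `(0, 1]`, and
`∏_{n=2}^{N}(1 − n^{-2}) = (N+1)/(2N) ≥ 1/2` (sharper: `≥ 6/π²`). [folklore] -/
theorem half_le_prod_primeFactors_filter_one_sub_inv_sq (N : ℕ) :
    1 / 2 ≤ ∏ p ∈ N.primeFactors with ¬ p ^ 2 ∣ N, (1 - ((p : ℝ) ^ 2)⁻¹) := by
  rcases Nat.eq_zero_or_pos N with rfl | hN
  · norm_num
  have hsub : (N.primeFactors.filter fun p ↦ ¬ p ^ 2 ∣ N) ⊆ Finset.Icc 2 N := fun p hp ↦ by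
    have hp' := (Finset.mem_filter.mp hp).1
    exact Finset.mem_Icc.mpr ⟨(Nat.prime_of_mem_primeFactors hp').two_le,
      Nat.le_of_dvd hN (Nat.dvd_of_mem_primeFactors hp')⟩
  have h1 : ∏ n ∈ Finset.Icc 2 N, (1 - ((n : ℝ) ^ 2)⁻¹) ≤
      ∏ p ∈ N.primeFactors with ¬ p ^ 2 ∣ N, (1 - ((p : ℝ) ^ 2)⁻¹) := by
    refine Finset.prod_le_prod_of_subset_of_le_one hsub (fun n hn ↦ ?_) (fun n hn _ ↦ ?_)
    · have hn2 : (2 : ℝ) ≤ n := by exact_mod_cast (Finset.mem_Icc.mp hn).1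
      have : ((n : ℝ) ^ 2)⁻¹ ≤ 1 := inv_le_one_of_one_le₀ (by nlinarith)
      linarith
    · have : 0 ≤ ((n : ℝ) ^ 2)⁻¹ := by positivity
      linarith
  refine le_trans ?_ h1
  rw [prod_Icc_one_sub_inv_sq N hN]
  have hN' : (0 : ℝ) < N := by exact_mod_cast hN
  rw [div_le_div_iff₀ (by norm_num) (by positivity)]
  linarith

/-- The bad-prime factor is at most `1`: `∏_{p ∥ N} (1 − p^{-2}) ≤ 1`. [folklore] -/
theorem prod_primeFactors_filter_one_sub_inv_sq_le_one (N : ℕ) :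
    ∏ p ∈ N.primeFactors with ¬ p ^ 2 ∣ N, (1 - ((p : ℝ) ^ 2)⁻¹) ≤ 1 := by
  refine Finset.prod_le_one (fun p hp ↦ ?_) (fun p hp ↦ ?_)
  · have h1 : (1 : ℝ) < p := by
      exact_mod_cast (Nat.prime_of_mem_primeFactors (Finset.mem_filter.mp hp).1).one_lt
    have : ((p : ℝ) ^ 2)⁻¹ ≤ 1 := inv_le_one_of_one_le₀ (by nlinarith)
    linarith
  · have : 0 ≤ ((p : ℝ) ^ 2)⁻¹ := by positivity
    linarith

/-- The bad-prime factor is positive. [folklore] -/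
theorem prod_primeFactors_filter_one_sub_inv_sq_pos (N : ℕ) :
    0 < ∏ p ∈ N.primeFactors with ¬ p ^ 2 ∣ N, (1 - ((p : ℝ) ^ 2)⁻¹) :=
  lt_of_lt_of_le (by norm_num) (half_le_prod_primeFactors_filter_one_sub_inv_sq N)

end Elementary

/-! ### Positivity of the edge limit for every newform -/

section Positivity

variable {N : ℕ} [NeZero N] {f : CuspForm (Gamma0 N) 2}

/-- The edge value `(8π³/N) ∏_{p ∥ N}(1 − p^{-2}) Re(f, f)` of `IsNewform0.tendsto_tprod_symmSq` is
POSITIVE for every newform `f ∈ S₂(Γ₀(N))` (`Re(f,f) ≥ e^{-4π}/(4π) > 0` for a normalised form,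
`peterssonProduct_re_ge_of_isNormalized`). [folklore] -/
theorem IsNewform0.symmSq_limit_pos (hf : IsNewform0 f) :
    0 < 8 * π ^ 3 / N * (∏ p ∈ N.primeFactors with ¬ p ^ 2 ∣ N, (1 - ((p : ℝ) ^ 2)⁻¹)) *
      (peterssonProduct (Gamma0 N) 2 f f).re := by
  have hNpos : (0 : ℝ) < N := by exact_mod_cast NeZero.pos N
  have hR : 0 < (peterssonProduct (Gamma0 N) 2 f f).re :=
    lt_of_lt_of_le (by positivity) (peterssonProduct_re_ge_of_isNormalized f hf.2.2)
  have hB := prod_primeFactors_filter_one_sub_inv_sq_pos N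
  positivity

/-- **Non-vanishing of the symmetric square at the edge of convergence** (Rankin 1939; the
tree's real-variable form): for every newform `f ∈ S₂(Γ₀(N))` the good-prime symmetric-square
Euler product `∏_{p ∤ N}((1 − p^{1−w})(1 − (a_p² − 2p)p^{-w} + p^{2−2w}))⁻¹` has a POSITIVE limit
as `w → 2⁺`. [cite: Rankin1939, §2 (the pole of Σ|aₙ|²n^{-s} at s = k and its residue)] -/
theorem IsNewform0.exists_pos_tendsto_tprod_symmSq (hf : IsNewform0 f) :
    ∃ L : ℝ, 0 < L ∧
      Tendsto (fun w : ℝ ↦ ∏' p : Nat.Primes, (if (p : ℕ) ∣ N then (1 : ℝ) else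
        ((1 - p * (p : ℝ) ^ (-w)) *
          (1 - (‖cuspCoeff f p‖ ^ 2 - 2 * p) * (p : ℝ) ^ (-w) + (p : ℝ) ^ 2 * ((p : ℝ) ^ (-w)) ^ 2))⁻¹))
        (𝓝[>] 2) (𝓝 L) :=
  ⟨_, hf.symmSq_limit_pos, hf.tendsto_tprod_symmSq⟩

/-- **Bridge to the naive value** `symmSqLOne f = 8π³ Re(f,f)/N` (`CuspFormSymmSquareLSeries`): for
a newform, the good-prime Euler product tends to `symmSqLOne f · ∏_{p ∥ N}(1 − p^{-2})` (the two
objects differ by the factors `(1 − a_p² p^{-w})⁻¹`, `a_p² ∈ {0, 1}`, at `p ∣ N`). [folklore] -/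
theorem IsNewform0.tendsto_tprod_symmSq_symmSqLOne (hf : IsNewform0 f) :
    Tendsto (fun w : ℝ ↦ ∏' p : Nat.Primes, (if (p : ℕ) ∣ N then (1 : ℝ) else
        ((1 - p * (p : ℝ) ^ (-w)) *
          (1 - (‖cuspCoeff f p‖ ^ 2 - 2 * p) * (p : ℝ) ^ (-w) + (p : ℝ) ^ 2 * ((p : ℝ) ^ (-w)) ^ 2))⁻¹))
      (𝓝[>] 2)
      (𝓝 (symmSqLOne f * ∏ p ∈ N.primeFactors with ¬ p ^ 2 ∣ N, (1 - ((p : ℝ) ^ 2)⁻¹))) := by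
  have h := hf.tendsto_tprod_symmSq
  rw [symmSqLOne_eq f]
  convert h using 2
  ring

end Positivity

/-! ### The converse reduction: the fact gives back Hoffstein–Lockhart's bound -/

section Converse

/-- **The named fact implies Hoffstein–Lockhart's bound** for the newforms of elliptic curves:
if `Re(f,f) ≥ c N^{1−ε}` then every limit `L` of the good-prime symmetric-square Euler product at
`w → 2⁺` satisfies `L = (8π³/N)∏_{p∥N}(1 − p^{-2}) Re(f,f) ≥ 4π³ c N^{-ε}` (`∏ ≥ 1/2`). Converse of
`murty_petersson_newform_lower_bound_of_symmSq_lower_bound`. [folklore] -/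
theorem symmSq_lower_bound_of_murty_petersson_newform_lower_bound
    (h : murty_petersson_newform_lower_bound) :
    ∀ ε : ℝ, 0 < ε → ∃ c : ℝ, 0 < c ∧
      ∀ (N : ℕ) [NeZero N] (W : WeierstrassCurve ℚ) [W.IsElliptic] (f : CuspForm (Gamma0 N) 2),
        IsNewformOf W f → ∀ L : ℝ,
          Tendsto (fun w : ℝ ↦ ∏' p : Nat.Primes, (if (p : ℕ) ∣ N then (1 : ℝ) else
            ((1 - p * (p : ℝ) ^ (-w)) *
              (1 - (‖cuspCoeff f p‖ ^ 2 - 2 * p) * (p : ℝ) ^ (-w) + (p : ℝ) ^ 2 * ((p : ℝ) ^ (-w)) ^ 2))⁻¹))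
            (𝓝[>] 2) (𝓝 L) →
          c * (N : ℝ) ^ (-ε) ≤ L := by
  intro ε hε
  obtain ⟨c, hc, hcN⟩ := h ε hε
  refine ⟨4 * π ^ 3 * c, by positivity, fun N _ W _ f hf L hL ↦ ?_⟩
  have hNpos : (0 : ℝ) < N := by exact_mod_cast NeZero.pos N
  rw [tendsto_nhds_unique hL hf.1.tendsto_tprod_symmSq]
  have hP := hcN N W f hf
  have hB := half_le_prod_primeFactors_filter_one_sub_inv_sq N
  have hRpos : 0 < (peterssonProduct (Gamma0 N) 2 f f).re := hf.peterssonProduct_re_pos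
  have hpow : (N : ℝ) ^ (1 - ε) = N * (N : ℝ) ^ (-ε) := by
    rw [show (1 : ℝ) - ε = 1 + -ε by ring, Real.rpow_add hNpos, Real.rpow_one]
  rw [hpow] at hP
  calc 4 * π ^ 3 * c * (N : ℝ) ^ (-ε) = 8 * π ^ 3 / N * (1 / 2) * (c * (N * (N : ℝ) ^ (-ε))) := by
        field_simp
        ring
    _ ≤ 8 * π ^ 3 / N * (∏ p ∈ N.primeFactors with ¬ p ^ 2 ∣ N, (1 - ((p : ℝ) ^ 2)⁻¹)) *
        (peterssonProduct (Gamma0 N) 2 f f).re := by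
        gcongr

/-- **What the fact says, given the tree**: `murty_petersson_newform_lower_bound` is EQUIVALENT to
Hoffstein–Lockhart's lower bound `≥ c(ε) N^{-ε}` for the edge limit of the good-prime
symmetric-square Euler product of the newforms of elliptic curves over `ℚ` (Hoffstein–Lockhart 1994,
Thm. 0.1 with the Goldfeld–Hoffstein–Lieman appendix, as quoted by Murty 1999, §2 p. 7: "by a
result of Hoffstein and Lockhart [HL], we have `log (f, f) > (1 − ε) log N`").
[cite: Murty1999CongruencePrimes, §2 p. 7 (the appeal to Hoffstein–Lockhart)] -/
theorem murty_petersson_newform_lower_bound_iff_symmSq_lower_bound :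
    murty_petersson_newform_lower_bound ↔
      ∀ ε : ℝ, 0 < ε → ∃ c : ℝ, 0 < c ∧
        ∀ (N : ℕ) [NeZero N] (W : WeierstrassCurve ℚ) [W.IsElliptic] (f : CuspForm (Gamma0 N) 2),
          IsNewformOf W f → ∀ L : ℝ,
            Tendsto (fun w : ℝ ↦ ∏' p : Nat.Primes, (if (p : ℕ) ∣ N then (1 : ℝ) else
              ((1 - p * (p : ℝ) ^ (-w)) *
                (1 - (‖cuspCoeff f p‖ ^ 2 - 2 * p) * (p : ℝ) ^ (-w) + (p : ℝ) ^ 2 * ((p : ℝ) ^ (-w)) ^ 2))⁻¹))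
              (𝓝[>] 2) (𝓝 L) →
            c * (N : ℝ) ^ (-ε) ≤ L :=
  ⟨symmSq_lower_bound_of_murty_petersson_newform_lower_bound,
    murty_petersson_newform_lower_bound_of_symmSq_lower_bound⟩

/-- The converse reduction in arithmetic form (Euler product in the integers `a_p(W)`,
cf. `murty_petersson_newform_lower_bound_of_symmSq_lower_bound_lFunction`). [folklore] -/
theorem symmSq_lower_bound_lFunction_of_murty_petersson_newform_lower_bound
    (h : murty_petersson_newform_lower_bound) :
    ∀ ε : ℝ, 0 < ε → ∃ c : ℝ, 0 < c ∧
      ∀ (N : ℕ) [NeZero N] (W : WeierstrassCurve ℚ) [W.IsElliptic] (f : CuspForm (Gamma0 N) 2),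
        IsNewformOf W f → ∀ L : ℝ,
          Tendsto (fun w : ℝ ↦ ∏' p : Nat.Primes, (if (p : ℕ) ∣ N then (1 : ℝ) else
            ((1 - p * (p : ℝ) ^ (-w)) *
              (1 - (((W.LFunction p : ℤ) : ℝ) ^ 2 - 2 * p) * (p : ℝ) ^ (-w) +
                (p : ℝ) ^ 2 * ((p : ℝ) ^ (-w)) ^ 2))⁻¹))
            (𝓝[>] 2) (𝓝 L) →
          c * (N : ℝ) ^ (-ε) ≤ L := by
  intro ε hε
  obtain ⟨c, hc, hcN⟩ := symmSq_lower_bound_of_murty_petersson_newform_lower_bound h ε hε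
  refine ⟨c, hc, fun N _ W _ f hf L hL ↦ hcN N W f hf L ?_⟩
  simp_rw [hf.norm_cuspCoeff_sq_eq]
  exact hL

/-- The equivalence in arithmetic form (integers `a_p(W)`). [cite: Murty1999CongruencePrimes, §2 p. 7 (the appeal to Hoffstein–Lockhart)] -/
theorem murty_petersson_newform_lower_bound_iff_symmSq_lower_bound_lFunction :
    murty_petersson_newform_lower_bound ↔
      ∀ ε : ℝ, 0 < ε → ∃ c : ℝ, 0 < c ∧
        ∀ (N : ℕ) [NeZero N] (W : WeierstrassCurve ℚ) [W.IsElliptic] (f : CuspForm (Gamma0 N) 2),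
          IsNewformOf W f → ∀ L : ℝ,
            Tendsto (fun w : ℝ ↦ ∏' p : Nat.Primes, (if (p : ℕ) ∣ N then (1 : ℝ) else
              ((1 - p * (p : ℝ) ^ (-w)) *
                (1 - (((W.LFunction p : ℤ) : ℝ) ^ 2 - 2 * p) * (p : ℝ) ^ (-w) +
                  (p : ℝ) ^ 2 * ((p : ℝ) ^ (-w)) ^ 2))⁻¹))
              (𝓝[>] 2) (𝓝 L) →
            c * (N : ℝ) ^ (-ε) ≤ L :=
  ⟨symmSq_lower_bound_lFunction_of_murty_petersson_newform_lower_bound,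
    murty_petersson_newform_lower_bound_of_symmSq_lower_bound_lFunction⟩

end Converse

/-! ### The fact through the naive symmetric-square value `symmSqLOne` -/

section NaiveValue

/-- **The named fact through the naive symmetric-square value.**
`murty_petersson_newform_lower_bound` (`Re(f,f) ≥ c(ε) N^{1−ε}` for the newforms of elliptic
curves) is EQUIVALENT to `symmSqLOne f ≥ c'(ε) N^{-ε}` for the same forms, where
`symmSqLOne f = lim_{w→2⁺} Re L^{naive}(Sym² f, w) = 8π³ Re(f,f)/N` (`symmSqLOne_eq`) — i.e. to
"`L(Sym² f_E, 1) ≫_ε N^{-ε}`" in the normalisation of Watkins 2004, §1 (Hoffstein–Lockhart 1994,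
Thm. 0.1; explicitly `≥ 0.033/log N⁽²⁾` for the complete `L`-function, Watkins 2004, Lemma 3.4).
Constants: `c' = 8π³c`, resp. `c = c'/(8π³)`. [cite: Watkins2004, §1 and Lemma 3.4] -/
theorem murty_petersson_newform_lower_bound_iff_symmSqLOne_lower_bound :
    murty_petersson_newform_lower_bound ↔
      ∀ ε : ℝ, 0 < ε → ∃ c : ℝ, 0 < c ∧
        ∀ (N : ℕ) [NeZero N] (W : WeierstrassCurve ℚ) [W.IsElliptic] (f : CuspForm (Gamma0 N) 2),
          IsNewformOf W f → c * (N : ℝ) ^ (-ε) ≤ symmSqLOne f := by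
  constructor
  · intro h ε hε
    obtain ⟨c, hc, hcN⟩ := h ε hε
    refine ⟨8 * π ^ 3 * c, by positivity, fun N _ W _ f hf ↦ ?_⟩
    have hNpos : (0 : ℝ) < N := by exact_mod_cast NeZero.pos N
    have hP := hcN N W f hf
    rw [symmSqLOne_eq f, show (1 : ℝ) - ε = 1 + -ε by ring, Real.rpow_add hNpos,
      Real.rpow_one] at *
    rw [le_div_iff₀ hNpos]
    nlinarith [Real.pi_pos, pow_pos Real.pi_pos 3]
  · intro h ε hε
    obtain ⟨c, hc, hcN⟩ := h ε hε
    refine ⟨c / (8 * π ^ 3), by positivity, fun N _ W _ f hf ↦ ?_⟩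
    have hNpos : (0 : ℝ) < N := by exact_mod_cast NeZero.pos N
    have hP := hcN N W f hf
    rw [symmSqLOne_eq f, le_div_iff₀ hNpos] at hP
    have hπ : (0 : ℝ) < 8 * π ^ 3 := by positivity
    rw [show (1 : ℝ) - ε = 1 + -ε by ring, Real.rpow_add hNpos, Real.rpow_one,
      div_mul_eq_mul_div, div_le_iff₀ hπ]
    nlinarith

/-- The named fact from a lower bound for the naive value (`←` of the previous theorem).
[cite: HoffsteinLockhart1994, Thm. 0.1] -/
theorem murty_petersson_newform_lower_bound_of_symmSqLOne_lower_bound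
    (h : ∀ ε : ℝ, 0 < ε → ∃ c : ℝ, 0 < c ∧
      ∀ (N : ℕ) [NeZero N] (W : WeierstrassCurve ℚ) [W.IsElliptic] (f : CuspForm (Gamma0 N) 2),
        IsNewformOf W f → c * (N : ℝ) ^ (-ε) ≤ symmSqLOne f) :
    murty_petersson_newform_lower_bound :=
  murty_petersson_newform_lower_bound_iff_symmSqLOne_lower_bound.mpr h

/-- The parametrisation-data form of the fact (the inequality for `D.f`,
`D : ModularParametrizationData W N`; formerly vendored separately as the duplicate named fact
`HoffsteinLockhart1994_peterssonProduct_lower_bound`, since merged into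
`murty_petersson_newform_lower_bound`) from the same input, through the bridge
`HoffsteinLockhart1994_peterssonProduct_lower_bound_of_murty`. [cite: HoffsteinLockhart1994, Thm. 0.1] -/
theorem HoffsteinLockhart1994_peterssonProduct_lower_bound_of_symmSqLOne_lower_bound
    (h : ∀ ε : ℝ, 0 < ε → ∃ c : ℝ, 0 < c ∧
      ∀ (N : ℕ) [NeZero N] (W : WeierstrassCurve ℚ) [W.IsElliptic] (f : CuspForm (Gamma0 N) 2),
        IsNewformOf W f → c * (N : ℝ) ^ (-ε) ≤ symmSqLOne f) :
    ∀ ε : ℝ, 0 < ε → ∃ c : ℝ, 0 < c ∧ ∀ (N : ℕ) [NeZero N] (W : WeierstrassCurve ℚ) [W.IsElliptic]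
      (D : ModularParametrizationData W N),
      c * (N : ℝ) ^ (1 - ε) ≤ (peterssonProduct (Gamma0 N) 2 D.f D.f).re :=
  HoffsteinLockhart1994_peterssonProduct_lower_bound_of_murty
    (murty_petersson_newform_lower_bound_of_symmSqLOne_lower_bound h)

end NaiveValue

end Literature.NumberTheory.EllipticCurves.ModularForms

end
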